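import Literature.AlgebraicGeometry.Frobenioids.Cor411OfPreSteps
import Literature.AlgebraicGeometry.Frobenioids.Thm49CompatOfPreStepsWeak
import HarnessLib

/-!
# Frobenioids I, Corollary 4.11 (iii)/(iv) AS TYPED from Corollary 4.11 (ii) and the conclusion of Theorem 3.4 (ii)
# — WEAKLY perf-factorial divisor monoids

Mochizuki, *The geometry of Frobenioids I: the general theory*, Kyushu J. Math. **62** (2008)
293–400, kurims text: Cor. 4.11 (iii), (iv) p. 92, proof p. 94 ("assertion (iii) follows formally from assertion
(ii); Theorem 4.9 … (iv) … by concatenating assertions (ii), (iii), with the fact that `Ψ` preserves Frobenius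
degrees [cf. Theorem 3.4, (iii)]") [cite: MochizukiFrdI2008, Cor. 4.11 (iii) p.92]; Theorem 4.9 pp. 88–90.

PROOF-ONLY file (cell abc-iut, layer L1, seat abc-iut-L1-t14; row «C411iii/iv-WEAK» = the [FrdI] Thm. 4.9 /
Cor. 4.11 (iii)(iv) chain over `IsPerfFactorialWeak`, block (T3)). WEAK-HYPOTHESIS TWINS of the six
perf-factorial-dependent theorems of `Cor411OfPreSteps.lean` (seats abc-iut-L1-d6 / abc-iut-L1-t14) with
"`Φ_i` perf-factorial" (Def. 2.4 (i) (a)–(d)) weakened to "`Φ_i` weakly perf-factorial" (`IsPerfFactorialWeak` =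
(a)(b)(c) + (d_ord) + (d_res); cell finding F-L2d2-1 — the divisor monoids `Φ₀(Y^log) ⊇ ∏_J ℤ_{≥0}` of [EtTh] §3,
where [EtTh] Cor. 3.8 (iii) / Prop. 5.3 quote Thm. 4.9 and [IUTchI] Def. 3.6 (a) quotes Cor. 4.11 (iv)):
* `FrdI.T49.exists_divisorMonoidIsoOver_div_of_preservesPreSteps_weak` — Thm. 4.9 at the `C`-level WITH the Div
  clause on ALL arrows, standard (quasi-isotropic) type, non-group-like objects on both sides, `C₁` rational at THE
  birationalization / support, modulo "`Ψ`, `Ψ⁻¹` preserve pre-steps" (route: isotropification, Thm. 3.4 (iii)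
  from pre-steps, the WEAK setting at THE perfections `FrdI.T42.settingWeak_perfection_asPrinted`, Thm. 4.9 with
  compatibility there `exists_thm49_compat_perfect_primarySupp_weak`, the hypothesis-free descents);
* `FrdI.exists_divisorMonoidIsoOver_div_of_cor411Setting_of_preservesPreSteps_weak` — the same in every case
  (group-like type: hypothesis-free `T49.nonempty_divisorMonoidIsoOver_of_isOfGroupLikeType`);
* `FrdI.cor411iii_ofFunctor_of_cor411ii_of_preservesPreSteps_weak` / `FrdI.cor411iv_ofFunctor_of_cor411ii_of_preservesPreSteps_weak`
  — the typed `Cor411iii` / `Cor411iv` at `ofFunctor` from the typed `Cor411ii` and the conclusion of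
  Thm. 3.4 (ii) for `Ψ`, `Ψ⁻¹`;
* `FrdI.cor411iii_ofFunctor_of_cor411ii_of_thm34ii_weak` / `FrdI.cor411iv_ofFunctor_of_cor411ii_of_thm34ii_weak` —
  the same from the typed `Thm34ii`.
The hypothesis-free `FrdI.preservesDegFr_of_cor411Setting_of_preservesPreSteps`, `PreFrobenioidData.cor411iii_of_cor411ii_of_thm49`,
`cor411iv_of_cor411ii` etc. are consumed BY NAME; proofs verbatim. No new definitions; nothing of the paper restated
or strengthened; nothing here is specific to the abc programme and no side is taken on [IUTchIII] Cor. 3.12.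
-/

namespace Literature.AlgebraicGeometry.Frobenioids

open CategoryTheory Opposite

universe w v v' u u'

namespace FrdI

open PreFrobenioid

variable {D₁ : Type u} [Category.{v} D₁] {Φ₁ : D₁ᵒᵖ ⥤ CommMonCat.{w}} {C₁ : Type u'} [Category.{v'} C₁]
  {D₂ : Type u} [Category.{v} D₂] {Φ₂ : D₂ᵒᵖ ⥤ CommMonCat.{w}} {C₂ : Type u'} [Category.{v'} C₂]
  {F₁ : C₁ ⥤ ElemFrobenioid Φ₁} {F₂ : C₂ ⥤ ElemFrobenioid Φ₂}

set_option backward.isDefEq.respectTransparency false in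
/-- (WEAK monoids: `Φ_i` weakly perf-factorial; twin of the strong theorem of the same name without `_weak`.) **[FrdI] Thm. 4.9 at the C-level WITH the Div clause of its construction, MODULO "`Ψ`, `Ψ⁻¹` preserve
pre-steps"** ("determines an isomorphism of monoids `Φ₁(A₁) ⥲ Φ₂(A₂)` which is functorial in `A₁`", p. 89; the
`Ψ^Φ` is built from the right-hand isomorphisms of Thm. 4.2 (iii), `Div(Ψ φ) = Ψ^Φ(Div φ)` for pre-steps `φ`,
then for all `φ` by Def. 1.3 (iv)(a) and Thm. 3.4 (iii)): for Frobenioids `C_i → F_{Φ_i}` of standard type with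
perf-factorial `Φ_i`, non-group-like objects `N_i` on both sides, `C₁` of rational type at THE birationalization /
support, and an equivalence `Ψ` such that `Ψ` and `Ψ⁻¹` preserve pre-steps, there is an isomorphism of functors
`Ψ^Φ : Φ₁ ⥲ Φ₂` over `Ψ` with `Ψ^Φ_A(Div φ) = Div(Ψ φ)` for EVERY arrow `φ : A → B` of `C₁`. No hypothesis on
the bases beyond print's standard type. Construction = seat abc-iut-L1-t14's
`T49.exists_divisorMonoidIsoOver_div_of_isOfFSMType` with the base-free transports (module docstring).
[cite: MochizukiFrdI2008, Thm. 4.9 p.89] -/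
theorem T49.exists_divisorMonoidIsoOver_div_of_preservesPreSteps_weak (hF₁ : IsFrobenioid F₁) (hF₂ : IsFrobenioid F₂)
    (hpf₁ : Objectwise (fun M _ => IsPerfFactorialWeak M) Φ₁) (hpf₂ : Objectwise (fun M _ => IsPerfFactorialWeak M) Φ₂)
    (hs₁ : (PreFrobenioidData.ofFunctor Φ₁ F₁).IsOfStandardType)
    (hs₂ : (PreFrobenioidData.ofFunctor Φ₂ F₂).IsOfStandardType)
    (hrat₁ : ∀ A : C₁, PreFrobenioidData.IsRational
      (biratData hF₁ (hasBiratSquares_of_isFrobenioid hF₁))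
      (S := PreFrobenioidData.ofFunctor Φ₁ F₁) (fun a 𝔭 => PrimarySupp a 𝔭) A)
    (Ψ : C₁ ≌ C₂)
    (hpre : ∀ ⦃X Y : C₁⦄ (φ : X ⟶ Y), IsPreStep F₁ φ → IsPreStep F₂ (Ψ.functor.map φ))
    (hpre' : ∀ ⦃X Y : C₂⦄ (φ : X ⟶ Y), IsPreStep F₂ φ → IsPreStep F₁ (Ψ.inverse.map φ))
    {N₁ : C₁} (hN₁ : ¬ IsGroupLikeObj F₁ N₁) {N₂ : C₂} (hN₂ : ¬ IsGroupLikeObj F₂ N₂) :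
    ∃ E : (PreFrobenioidData.ofFunctor Φ₁ F₁).DivisorMonoidIsoOver (PreFrobenioidData.ofFunctor Φ₂ F₂) Ψ,
      ∀ ⦃A B : C₁⦄ (φ : A ⟶ B), E.iso A (Div F₁ φ) = Div F₂ (Ψ.functor.map φ) := by
  have hP₁ := hF₁.isPreFrobenioid
  have hP₂ := hF₂.isPreFrobenioid
  have hq₁ := hs₁.quasiIsotropic
  have hq₂ := hs₂.quasiIsotropic
  have hnd₁ : IsNonDilatingOn Φ₁ := FrdI.isNonDilatingOn_of_ofFunctor hs₁.nonDilating
  have hnd₂ : IsNonDilatingOn Φ₂ := FrdI.isNonDilatingOn_of_ofFunctor hs₂.nonDilating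
  -- (1) the isotropifications and `Ψ^istr` (Thm. 3.4 (i); Rmk. 4.5.1)
  haveI : (isotropicObjects F₂).IsClosedUnderIsomorphisms := ⟨fun e hX => IsIsotropic.of_iso hP₂ e.symm hX⟩
  have hinvImg := FrdI.isotropicObjects_inverseImage hF₁ hq₁ hq₂ Ψ
  let Ψi : Istr F₁ ≌ Istr F₂ := Ψ.congrFullSubcategory hinvImg
  have hI₁ := isFrobenioid_istr hF₁
  have hI₂ := isFrobenioid_istr hF₂
  have hsI₁ := isOfStandardType_istr hF₁ hs₁
  have hsI₂ := isOfStandardType_istr hF₂ hs₂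
  have hNI₁ := T49.not_isGroupLikeObj_hullIstr hF₁ hN₁
  have hNI₂ := T49.not_isGroupLikeObj_hullIstr hF₂ hN₂
  -- the pre-steps of `C^istr` are the pre-steps of `C` between isotropic objects: `Ψ^istr`, `(Ψ^istr)⁻¹`
  -- preserve them
  have hΨi₁ : ∀ ⦃a b : Istr F₁⦄ (f : a ⟶ b), IsPreStep (istrFunctor F₁) f →
      IsPreStep (istrFunctor F₂) (Ψi.functor.map f) := fun a b f hf => hpre f.hom hf
  have hinvI : ∀ ⦃X Y : Istr F₂⦄ (g : X ⟶ Y), IsPreStep (istrFunctor F₂) g →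
      IsPreStep (istrFunctor F₁) (Ψi.inverse.map g) := fun X Y g hg => hpre' g.hom hg
  -- Thm. 3.4 (iii) for `Ψ^istr` from pre-step preservation: compatible with arrows of Frobenius type
  have hΨi : IsFrobeniusCompatible (istrFunctor F₁) (istrFunctor F₂) Ψi.functor :=
    FrdI.isFrobeniusCompatible_of_preservesPreSteps hI₁ hI₂ hsI₁.quasiIsotropic hsI₂.quasiIsotropic
      hsI₁.nonDilating hsI₂.nonDilating Ψi (fun _ _ f h => hΨi₁ f h) (fun _ _ f h => hinvI f h)
      ⟨_, hNI₁⟩ ⟨_, hNI₂⟩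
  -- (2) the perfections `(C_i^istr)^pf` and the setting of the proof of Thm. 4.2 there, from the PRINTED
  -- hypotheses on the `C_i^istr` (standard, isotropic, not group-like; `Φ_i` perf-factorial)
  have hTI : PreFrobenioidData.Thm42Setting (PreFrobenioidData.ofFunctor Φ₁ (istrFunctor F₁))
      (PreFrobenioidData.ofFunctor Φ₂ (istrFunctor F₂)) :=
    ⟨⟨hsI₁, hsI₂⟩, ⟨(PreFrobenioidData.ofFunctor_isOfIsotropicType _).2 isOfIsotropicType_istr,
      (PreFrobenioidData.ofFunctor_isOfIsotropicType _).2 isOfIsotropicType_istr⟩,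
      ⟨fun h => hNI₁ ((PreFrobenioidData.ofFunctor_isGroupLikeObj _ _).1 (h.obj _)),
        fun h => hNI₂ ((PreFrobenioidData.ofFunctor_isGroupLikeObj _ _).1 (h.obj _))⟩⟩
  have hPf₁ := PreFrobenioid.Perfection.isFrobenioid hI₁
    (FrdI.T42.isFrobeniusIsotropic_of_isOfIsotropicType hI₁ isOfIsotropicType_istr)
  haveI := PreFrobenioid.Perfection.map_isEquivalence (hF₁ := hI₁) (hF₂ := hI₂) Ψi hΨi
  have S := FrdI.T42.settingWeak_perfection_asPrinted Ψi hI₁ hI₂ hpf₁ hpf₂ hTI hΨi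
  have hndp₂ : IsNonDilatingOn (PreFrobenioid.Perfection.ops hI₂).monFunctor :=
    FrdI.isNonDilatingOn_of_ofFunctor (F := (PreFrobenioid.Perfection.ops hI₂).toFunctor)
      (PreFrobenioid.Perfection.isNonDilatingOn_ops hI₂ hsI₂.nonDilating)
  -- Rmk. 4.5.1 / Prop. 5.5 (iii): rationality of `C₁^istr`, `(C₁^istr)^pf`
  have hratI : ∀ A : Istr F₁, PreFrobenioidData.IsRational
      (biratData hI₁ (hasBiratSquares_of_isFrobenioid hI₁))
      (S := PreFrobenioidData.ofFunctor Φ₁ (istrFunctor F₁)) (fun a 𝔭 => PrimarySupp a 𝔭) A :=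
    fun A => isRational_istr_of hF₁ hrat₁ A
  have hratP : ∀ ⦃X : PreFrobenioid.Perfection hI₁⦄,
      IsUniversallyDivFrobeniusTrivial (PreFrobenioid.Perfection.ops hI₁).toFunctor X →
        PreFrobenioidData.IsRational (biratData S.isFrobenioid₁ (hasBiratSquares_of_isFrobenioid S.isFrobenioid₁))
          (S := PreFrobenioidData.ofFunctor _ (PreFrobenioid.Perfection.ops hI₁).toFunctor)
          (fun a 𝔭 => PrimarySupp a 𝔭) X :=
    fun X _ => PreFrobenioid.Perfection.isRational_perfection_of hI₁ hPf₁ hratI X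
  -- (3) Thm. 4.9 at the perfect-isotropic level, with the Div clause on pre-steps
  obtain ⟨E', -, -, hE', -⟩ := T49.exists_thm49_compat_perfect_primarySupp_weak S hndp₂ hratP
  -- (4) descent to `C_i^istr` WITH the Div clause
  obtain ⟨EI, -, hEI⟩ := T49.exists_divisorMonoidIsoOver_of_perfection hI₁ hI₂ Ψi hΨi hinvI E'
    (fun X Y f hf => hE' f hf)
  -- (5) extension along the isotropic hulls, agreeing with `EI` on isotropic objects
  have hhull : ∀ ⦃A B : C₁⦄ (h : A ⟶ B), IsIsotropicHull F₁ h → IsIsotropicHull F₂ (Ψ.functor.map h) :=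
    fun A B h hh => FrdI.isIsotropicHull_map hF₁ hF₂ hq₁ hq₂ Ψ hh
  obtain ⟨E, hE⟩ := T49.exists_divisorMonoidIsoOver_of_isotropic F₁ F₂ Ψ hF₁ hhull (fun A hA => EI.iso ⟨A, hA⟩)
    (fun A B hA hB φ x => EI.natural (A := (⟨A, hA⟩ : Istr F₁)) (B := ⟨B, hB⟩) (ObjectProperty.homMk φ) x)
  have hEpre : ∀ ⦃A B : C₁⦄ (φ : A ⟶ B), IsPreStep F₁ φ → E.iso A (Div F₁ φ) = Div F₂ (Ψ.functor.map φ) :=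
    T49.iso_div_of_agree_isotropic F₁ F₂ Ψ hF₁ hhull (fun A hA => EI.iso ⟨A, hA⟩)
      (fun A B hA hB φ hφ => hEI (A := (⟨A, hA⟩ : Istr F₁)) (B := ⟨B, hB⟩) (ObjectProperty.homMk φ) hφ) E hE
  -- (6) from pre-steps to all arrows (Def. 1.3 (iv)(a); Thm. 3.4 (iii) from pre-step preservation)
  exact ⟨E, E.iso_div_of_preSteps hF₁ hF₂
    (fun _ _ φ hφ => FrdI.OfPreSteps.isFrobeniusType_map_quasiIsotropic hF₁ hF₂ hq₁ hq₂ hnd₁ hnd₂ Ψ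
      (fun _ _ φ h => hpre φ h) (fun _ _ φ h => hpre' φ h) hN₁ hN₂ hφ)
    (fun _ _ φ hφ => FrdI.OfPreSteps.isPullbackMorphism_map_quasiIsotropic hF₁ hF₂ hq₁ hq₂ hnd₁ hnd₂ Ψ
      (fun _ _ φ h => hpre φ h) (fun _ _ φ h => hpre' φ h) hN₁ hN₂ hφ)
    hEpre⟩

/-- (WEAK monoids: `Φ_i` weakly perf-factorial; twin of the strong theorem of the same name without `_weak`.) **Thm. 4.9's `Ψ^Φ` with its Div clause under the hypotheses of Cor. 4.11, MODULO the conclusion of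
Thm. 3.4 (ii) for `Ψ`, `Ψ⁻¹`** — in every case: non-group-like objects on both sides =
`T49.exists_divisorMonoidIsoOver_div_of_preservesPreSteps_weak`; group-like type = "Theorem 4.9 is vacuous" (p. 89:
the `Φ_i` are trivial, `T49.nonempty_divisorMonoidIsoOver_of_isOfGroupLikeType`). No base hypothesis.
[cite: MochizukiFrdI2008, Thm. 4.9 p.89] -/
theorem exists_divisorMonoidIsoOver_div_of_cor411Setting_of_preservesPreSteps_weak (hF₁ : IsFrobenioid F₁)
    (hF₂ : IsFrobenioid F₂)
    (hpf₁ : Objectwise (fun M _ => IsPerfFactorialWeak M) Φ₁) (hpf₂ : Objectwise (fun M _ => IsPerfFactorialWeak M) Φ₂)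
    (hrat₁ : ∀ A : C₁, PreFrobenioidData.IsRational
      (biratData hF₁ (hasBiratSquares_of_isFrobenioid hF₁))
      (S := PreFrobenioidData.ofFunctor Φ₁ F₁) (fun a 𝔭 => PrimarySupp a 𝔭) A)
    (Ψ : C₁ ≌ C₂)
    (h₁₂ : PreFrobenioidData.PreservesMor Ψ.functor (PreFrobenioidData.ofFunctor Φ₁ F₁).IsPreStep
      (PreFrobenioidData.ofFunctor Φ₂ F₂).IsPreStep)
    (h₂₁ : PreFrobenioidData.PreservesMor Ψ.inverse (PreFrobenioidData.ofFunctor Φ₂ F₂).IsPreStep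
      (PreFrobenioidData.ofFunctor Φ₁ F₁).IsPreStep)
    (hG : PreFrobenioidData.PreservesObj Ψ.functor (PreFrobenioidData.ofFunctor Φ₁ F₁).IsGroupLikeObj
      (PreFrobenioidData.ofFunctor Φ₂ F₂).IsGroupLikeObj)
    (hG' : PreFrobenioidData.PreservesObj Ψ.inverse (PreFrobenioidData.ofFunctor Φ₂ F₂).IsGroupLikeObj
      (PreFrobenioidData.ofFunctor Φ₁ F₁).IsGroupLikeObj)
    (hs : (PreFrobenioidData.ofFunctor Φ₁ F₁).Cor411Setting (PreFrobenioidData.ofFunctor Φ₂ F₂) Ψ) :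
    ∃ E : (PreFrobenioidData.ofFunctor Φ₁ F₁).DivisorMonoidIsoOver (PreFrobenioidData.ofFunctor Φ₂ F₂) Ψ,
      ∀ ⦃A B : C₁⦄ (φ : A ⟶ B), E.iso A (Div F₁ φ) = Div F₂ (Ψ.functor.map φ) := by
  rcases FrdI.OfPreSteps.groupLike_dichotomy Ψ hG hG' with ⟨hg₁, hg₂⟩ | ⟨⟨N₁, hN₁⟩, ⟨N₂, hN₂⟩⟩
  · obtain ⟨E⟩ := T49.nonempty_divisorMonoidIsoOver_of_isOfGroupLikeType F₁ F₂ Ψ hg₁ hg₂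
    exact ⟨E, fun A B φ => (hg₂.obj (Ψ.functor.obj A) _).trans (hg₂.obj (Ψ.functor.obj A) _).symm⟩
  · rw [PreFrobenioidData.ofFunctor_isGroupLikeObj] at hN₁ hN₂
    exact T49.exists_divisorMonoidIsoOver_div_of_preservesPreSteps_weak hF₁ hF₂ hpf₁ hpf₂ hs.standard.1 hs.standard.2
      hrat₁ Ψ (fun _ _ φ h => h₁₂ φ h) (fun _ _ φ h => h₂₁ φ h) hN₁ hN₂

/-- (WEAK monoids: `Φ_i` weakly perf-factorial; twin of the strong theorem of the same name without `_weak`.) **[FrdI] Cor. 4.11 (iii) AS TYPED from Cor. 4.11 (ii) and the conclusion of Thm. 3.4 (ii), with NO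
hypothesis on the bases** ("assertion (iii) follows formally from assertion (ii); Theorem 4.9", p. 94): for
Frobenioids `C_i → F_{Φ_i}` with perf-factorial `Φ_i`, `C₁` of rational type at THE birationalization /
support, and an equivalence `Ψ` such that `Ψ`, `Ψ⁻¹` preserve pre-steps and group-like objects, the typed
Cor. 4.11 (ii) for `Ψ` implies the typed Cor. 4.11 (iii): `Ψ^Φ` over `Ψ` is
`exists_divisorMonoidIsoOver_div_of_cor411Setting_of_preservesPreSteps_weak`, its descent `D^* ⥲ D` to a `Ψ^Φ` over
`Ψ^Base` is seat abc-iut-L1-d6's `DivisorMonoidIsoOver.exists_overBase` (inside `cor411iii_of_cor411ii_of_thm49`).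
Twin of seat abc-iut-L1-t14's `cor411iii_of_cor411ii_of_isOfFSMType`. [cite: MochizukiFrdI2008, Cor. 4.11 (iii) p.92] -/
theorem cor411iii_ofFunctor_of_cor411ii_of_preservesPreSteps_weak (hF₁ : IsFrobenioid F₁) (hF₂ : IsFrobenioid F₂)
    (hpf₁ : Objectwise (fun M _ => IsPerfFactorialWeak M) Φ₁) (hpf₂ : Objectwise (fun M _ => IsPerfFactorialWeak M) Φ₂)
    (hrat₁ : ∀ A : C₁, PreFrobenioidData.IsRational
      (biratData hF₁ (hasBiratSquares_of_isFrobenioid hF₁))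
      (S := PreFrobenioidData.ofFunctor Φ₁ F₁) (fun a 𝔭 => PrimarySupp a 𝔭) A)
    (Ψ : C₁ ≌ C₂) (R₁ : (PreFrobenioidData.ofFunctor Φ₁ F₁).RSParams)
    (R₂ : (PreFrobenioidData.ofFunctor Φ₂ F₂).RSParams)
    (h₁₂ : PreFrobenioidData.PreservesMor Ψ.functor (PreFrobenioidData.ofFunctor Φ₁ F₁).IsPreStep
      (PreFrobenioidData.ofFunctor Φ₂ F₂).IsPreStep)
    (h₂₁ : PreFrobenioidData.PreservesMor Ψ.inverse (PreFrobenioidData.ofFunctor Φ₂ F₂).IsPreStep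
      (PreFrobenioidData.ofFunctor Φ₁ F₁).IsPreStep)
    (hG : PreFrobenioidData.PreservesObj Ψ.functor (PreFrobenioidData.ofFunctor Φ₁ F₁).IsGroupLikeObj
      (PreFrobenioidData.ofFunctor Φ₂ F₂).IsGroupLikeObj)
    (hG' : PreFrobenioidData.PreservesObj Ψ.inverse (PreFrobenioidData.ofFunctor Φ₂ F₂).IsGroupLikeObj
      (PreFrobenioidData.ofFunctor Φ₁ F₁).IsGroupLikeObj)
    (h2 : (PreFrobenioidData.ofFunctor Φ₁ F₁).Cor411ii (PreFrobenioidData.ofFunctor Φ₂ F₂) Ψ) :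
    (PreFrobenioidData.ofFunctor Φ₁ F₁).Cor411iii (PreFrobenioidData.ofFunctor Φ₂ F₂) Ψ R₁ R₂ := by
  intro hs hR₁ hR₂
  obtain ⟨E, -⟩ := exists_divisorMonoidIsoOver_div_of_cor411Setting_of_preservesPreSteps_weak hF₁ hF₂ hpf₁ hpf₂ hrat₁
    Ψ h₁₂ h₂₁ hG hG' hs
  exact PreFrobenioidData.cor411iii_of_cor411ii_of_thm49 _ _ Ψ R₁ R₂ (exists_base_iso_of_isFrobenioid F₁ hF₁)
    (exists_preSteps_of_base_iso F₁ hF₁) (fun A _ f => exists_arrow_over_base F₁ hF₁ A f) h2 (fun _ _ => ⟨E⟩)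
    hs hR₁ hR₂

/-- (WEAK monoids: `Φ_i` weakly perf-factorial; twin of the strong theorem of the same name without `_weak`.) **[FrdI] Cor. 4.11 (iv) AS TYPED from Cor. 4.11 (ii) and the conclusion of Thm. 3.4 (ii), with NO
hypothesis on the bases** ("by concatenating assertions (ii), (iii), with the fact that `Ψ` preserves Frobenius
degrees [cf. Theorem 3.4, (iii)]", p. 94): for Frobenioids `C_i → F_{Φ_i}` with perf-factorial `Φ_i`, `C₁` of
rational type at THE birationalization / support, and an equivalence `Ψ` such that `Ψ`, `Ψ⁻¹` preserve pre-steps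
and group-like objects, the typed Cor. 4.11 (ii) for `Ψ` implies the typed Cor. 4.11 (iv): `Ψ^Φ` with its Div
clause is `exists_divisorMonoidIsoOver_div_of_cor411Setting_of_preservesPreSteps_weak`, the degrees are
`preservesDegFr_of_cor411Setting_of_preservesPreSteps`, the descent and concatenation are seat abc-iut-L1-d6's
`PreFrobenioidData.cor411iv_of_cor411ii`. Twin of seat abc-iut-L1-t14's `cor411iv_of_cor411ii_of_isOfFSMType`
(both cases at once). [cite: MochizukiFrdI2008, Cor. 4.11 (iv) p.92] -/
theorem cor411iv_ofFunctor_of_cor411ii_of_preservesPreSteps_weak (hF₁ : IsFrobenioid F₁) (hF₂ : IsFrobenioid F₂)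
    (hpf₁ : Objectwise (fun M _ => IsPerfFactorialWeak M) Φ₁) (hpf₂ : Objectwise (fun M _ => IsPerfFactorialWeak M) Φ₂)
    (hrat₁ : ∀ A : C₁, PreFrobenioidData.IsRational
      (biratData hF₁ (hasBiratSquares_of_isFrobenioid hF₁))
      (S := PreFrobenioidData.ofFunctor Φ₁ F₁) (fun a 𝔭 => PrimarySupp a 𝔭) A)
    (Ψ : C₁ ≌ C₂) (R₁ : (PreFrobenioidData.ofFunctor Φ₁ F₁).RSParams)
    (R₂ : (PreFrobenioidData.ofFunctor Φ₂ F₂).RSParams)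
    (h₁₂ : PreFrobenioidData.PreservesMor Ψ.functor (PreFrobenioidData.ofFunctor Φ₁ F₁).IsPreStep
      (PreFrobenioidData.ofFunctor Φ₂ F₂).IsPreStep)
    (h₂₁ : PreFrobenioidData.PreservesMor Ψ.inverse (PreFrobenioidData.ofFunctor Φ₂ F₂).IsPreStep
      (PreFrobenioidData.ofFunctor Φ₁ F₁).IsPreStep)
    (hG : PreFrobenioidData.PreservesObj Ψ.functor (PreFrobenioidData.ofFunctor Φ₁ F₁).IsGroupLikeObj
      (PreFrobenioidData.ofFunctor Φ₂ F₂).IsGroupLikeObj)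
    (hG' : PreFrobenioidData.PreservesObj Ψ.inverse (PreFrobenioidData.ofFunctor Φ₂ F₂).IsGroupLikeObj
      (PreFrobenioidData.ofFunctor Φ₁ F₁).IsGroupLikeObj)
    (h2 : (PreFrobenioidData.ofFunctor Φ₁ F₁).Cor411ii (PreFrobenioidData.ofFunctor Φ₂ F₂) Ψ) :
    (PreFrobenioidData.ofFunctor Φ₁ F₁).Cor411iv (PreFrobenioidData.ofFunctor Φ₂ F₂) Ψ R₁ R₂ := by
  intro hs hR₁ hR₂
  obtain ⟨E, hdiv⟩ := exists_divisorMonoidIsoOver_div_of_cor411Setting_of_preservesPreSteps_weak hF₁ hF₂ hpf₁ hpf₂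
    hrat₁ Ψ h₁₂ h₂₁ hG hG' hs
  exact PreFrobenioidData.cor411iv_of_cor411ii _ _ Ψ R₁ R₂ (exists_base_iso_of_isFrobenioid F₁ hF₁)
    (exists_preSteps_of_base_iso F₁ hF₁) (fun A _ f => exists_arrow_over_base F₁ hF₁ A f) h2 E hdiv
    (preservesDegFr_of_cor411Setting_of_preservesPreSteps hF₁ hF₂ Ψ h₁₂ h₂₁ hG hG' hs) hs hR₁ hR₂

/-- (WEAK monoids: `Φ_i` weakly perf-factorial; twin of the strong theorem of the same name without `_weak`.) **[FrdI] Cor. 4.11 (iii) AS TYPED from Cor. 4.11 (ii) and Thm. 3.4 (ii) AS TYPED** — the typed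
`PreFrobenioidData.Thm34ii` for `Ψ` and for `Ψ⁻¹` (its antecedents "quasi-isotropic" and "`D_i` of
FSMFF-type" are clauses (a), (d) of standard type, Def. 3.1 (i), supplied by `Cor411Setting`), Frobenioids with
perf-factorial `Φ_i`, `C₁` of rational type at THE birationalization / support; NO hypothesis on the bases.
[cite: MochizukiFrdI2008, Cor. 4.11 (iii) p.92] -/
theorem cor411iii_ofFunctor_of_cor411ii_of_thm34ii_weak (hF₁ : IsFrobenioid F₁) (hF₂ : IsFrobenioid F₂)
    (hpf₁ : Objectwise (fun M _ => IsPerfFactorialWeak M) Φ₁) (hpf₂ : Objectwise (fun M _ => IsPerfFactorialWeak M) Φ₂)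
    (hrat₁ : ∀ A : C₁, PreFrobenioidData.IsRational
      (biratData hF₁ (hasBiratSquares_of_isFrobenioid hF₁))
      (S := PreFrobenioidData.ofFunctor Φ₁ F₁) (fun a 𝔭 => PrimarySupp a 𝔭) A)
    (Ψ : C₁ ≌ C₂) (R₁ : (PreFrobenioidData.ofFunctor Φ₁ F₁).RSParams)
    (R₂ : (PreFrobenioidData.ofFunctor Φ₂ F₂).RSParams)
    (h : (PreFrobenioidData.ofFunctor Φ₁ F₁).Thm34ii (PreFrobenioidData.ofFunctor Φ₂ F₂) Ψ)
    (h' : (PreFrobenioidData.ofFunctor Φ₂ F₂).Thm34ii (PreFrobenioidData.ofFunctor Φ₁ F₁) Ψ.symm)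
    (h2 : (PreFrobenioidData.ofFunctor Φ₁ F₁).Cor411ii (PreFrobenioidData.ofFunctor Φ₂ F₂) Ψ) :
    (PreFrobenioidData.ofFunctor Φ₁ F₁).Cor411iii (PreFrobenioidData.ofFunctor Φ₂ F₂) Ψ R₁ R₂ := by
  intro hs
  obtain ⟨h₁₂, -, hG⟩ := h hs.standard.1.quasiIsotropic hs.standard.2.quasiIsotropic hs.standard.1.fsmff
    hs.standard.2.fsmff
  obtain ⟨h₂₁, -, hG'⟩ := h' hs.standard.2.quasiIsotropic hs.standard.1.quasiIsotropic hs.standard.2.fsmff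
    hs.standard.1.fsmff
  exact cor411iii_ofFunctor_of_cor411ii_of_preservesPreSteps_weak hF₁ hF₂ hpf₁ hpf₂ hrat₁ Ψ R₁ R₂ h₁₂ h₂₁ hG hG' h2 hs

/-- (WEAK monoids: `Φ_i` weakly perf-factorial; twin of the strong theorem of the same name without `_weak`.) **[FrdI] Cor. 4.11 (iv) AS TYPED from Cor. 4.11 (ii) and Thm. 3.4 (ii) AS TYPED** — the typed
`PreFrobenioidData.Thm34ii` for `Ψ` and for `Ψ⁻¹` (antecedents from standard type (a), (d) of `Cor411Setting`),
Frobenioids with perf-factorial `Φ_i`, `C₁` of rational type at THE birationalization / support; NO hypothesis on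
the bases. [cite: MochizukiFrdI2008, Cor. 4.11 (iv) p.92] -/
theorem cor411iv_ofFunctor_of_cor411ii_of_thm34ii_weak (hF₁ : IsFrobenioid F₁) (hF₂ : IsFrobenioid F₂)
    (hpf₁ : Objectwise (fun M _ => IsPerfFactorialWeak M) Φ₁) (hpf₂ : Objectwise (fun M _ => IsPerfFactorialWeak M) Φ₂)
    (hrat₁ : ∀ A : C₁, PreFrobenioidData.IsRational
      (biratData hF₁ (hasBiratSquares_of_isFrobenioid hF₁))
      (S := PreFrobenioidData.ofFunctor Φ₁ F₁) (fun a 𝔭 => PrimarySupp a 𝔭) A)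
    (Ψ : C₁ ≌ C₂) (R₁ : (PreFrobenioidData.ofFunctor Φ₁ F₁).RSParams)
    (R₂ : (PreFrobenioidData.ofFunctor Φ₂ F₂).RSParams)
    (h : (PreFrobenioidData.ofFunctor Φ₁ F₁).Thm34ii (PreFrobenioidData.ofFunctor Φ₂ F₂) Ψ)
    (h' : (PreFrobenioidData.ofFunctor Φ₂ F₂).Thm34ii (PreFrobenioidData.ofFunctor Φ₁ F₁) Ψ.symm)
    (h2 : (PreFrobenioidData.ofFunctor Φ₁ F₁).Cor411ii (PreFrobenioidData.ofFunctor Φ₂ F₂) Ψ) :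
    (PreFrobenioidData.ofFunctor Φ₁ F₁).Cor411iv (PreFrobenioidData.ofFunctor Φ₂ F₂) Ψ R₁ R₂ := by
  intro hs
  obtain ⟨h₁₂, -, hG⟩ := h hs.standard.1.quasiIsotropic hs.standard.2.quasiIsotropic hs.standard.1.fsmff
    hs.standard.2.fsmff
  obtain ⟨h₂₁, -, hG'⟩ := h' hs.standard.2.quasiIsotropic hs.standard.1.quasiIsotropic hs.standard.2.fsmff
    hs.standard.1.fsmff
  exact cor411iv_ofFunctor_of_cor411ii_of_preservesPreSteps_weak hF₁ hF₂ hpf₁ hpf₂ hrat₁ Ψ R₁ R₂ h₁₂ h₂₁ hG hG' h2 hs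

end FrdI

end Literature.AlgebraicGeometry.Frobenioids
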